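import Summits.KontsevichZagierPeriods.KontsevichZagierPeriods.Theorems.SoloBlindLineMoves
import HarnessLib

/-!
# The principal fifth root is `ℚ`-semialgebraic on the closed upper half-plane

Kontsevich–Zagier's rules only move `ℚ`-semialgebraic functions.  To run Cauchy's theorem for the
Fermat-quintic differentials `(z(1-z))^{p/5-1} dz` inside the rules (files `SoloBlindCauchy*`) we
need the real and imaginary parts of the PRINCIPAL branch `w ↦ w^{1/5}` as `ℚ`-semialgebraic
functions of `(Re w, Im w)`.  On the closed upper half-plane minus the origin the principal fifth
root `k = w^{1/5}` (`arg k = arg w / 5 ∈ [0, π/5]`) is singled out among the five roots of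
`k⁵ = w` by POLYNOMIAL conditions with rational coefficients,

  `k⁵ = w,   0 < Re k,   0 ≤ Im k < Re k`

(the sector `0 ≤ arg k < π/4` contains `arg w/5` and none of `arg w/5 ± 2π/5, ± 4π/5`: the
separating slope `1 = tan(π/4)` is rational because `π/5 < π/4 < 2π/5`), so its graph is the
projection of a `ℚ`-semialgebraic subset of `ℝ⁴` and the Tarski–Seidenberg theorem
(`tarski_seidenberg_real_holds`) makes `Re k`, `Im k` semialgebraic (`isSemialgebraicFunOn_rootRe`,
`isSemialgebraicFunOn_rootIm`).

References: J. Bochnak, M. Coste, M.-F. Roy, *Real algebraic geometry* (1998), Thm 2.2.1,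
Prop. 2.2.6; M. Kontsevich, D. Zagier, *Periods* (2001), §1.1.
-/

noncomputable section

namespace Summit.KontsevichZagierPeriods.KontsevichZagierPeriods.Theorems

open Set Complex
open Literature.ModelTheory.ExponentialFields (IsSemialgebraic isSemialgebraic_setOf_eval_pos
  isSemialgebraic_setOf_eval_eq_zero isSemialgebraic_setOf_eval_nonneg
  isSemialgebraic_setOf_eval_ne_zero tarski_seidenberg_real_holds)
open MvPolynomial (aeval X)
open Literature.NumberTheory.Transcendental

namespace SoloBlind

/-! ## The principal fifth root and its sector -/

/-- The principal fifth root `w^{1/5}`. -/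
def root5 (w : ℂ) : ℂ := w ^ ((5 : ℂ)⁻¹)

/-- `(w^{1/5})⁵ = w`. -/
theorem root5_pow (w : ℂ) : root5 w ^ 5 = w := cpow_nat_inv_pow w (by norm_num)

/-- Polar formula for the real part of the principal fifth root. -/
theorem root5_re (w : ℂ) : (root5 w).re = ‖w‖ ^ (5⁻¹ : ℝ) * Real.cos (arg w * 5⁻¹) := by
  rw [root5, ← ofReal_ofNat, ← ofReal_inv, cpow_ofReal_re]

/-- Polar formula for the imaginary part of the principal fifth root. -/
theorem root5_im (w : ℂ) : (root5 w).im = ‖w‖ ^ (5⁻¹ : ℝ) * Real.sin (arg w * 5⁻¹) := by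
  rw [root5, ← ofReal_ofNat, ← ofReal_inv, cpow_ofReal_im]

/-- For `Im w ≥ 0` the fifth of the argument lies in `[0, π/5]`. -/
theorem arg_div_five_mem {w : ℂ} (him : 0 ≤ w.im) :
    0 ≤ arg w * 5⁻¹ ∧ arg w * 5⁻¹ < Real.pi / 4 := by
  have h0 : 0 ≤ arg w := arg_nonneg_iff.mpr him
  have h1 : arg w ≤ Real.pi := arg_le_pi w
  constructor
  · positivity
  · nlinarith [Real.pi_pos]

/-- In the sector `[0, π/4)` one has `0 ≤ sin θ < cos θ`. -/
theorem sin_lt_cos_of_mem {θ : ℝ} (h0 : 0 ≤ θ) (h1 : θ < Real.pi / 4) :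
    0 < Real.cos θ ∧ 0 ≤ Real.sin θ ∧ Real.sin θ < Real.cos θ := by
  have hpi := Real.pi_pos
  have hc : Real.cos (Real.pi / 4) < Real.cos θ :=
    Real.cos_lt_cos_of_nonneg_of_le_pi_div_two h0 (by linarith) h1
  have hs : Real.sin θ < Real.sin (Real.pi / 4) :=
    Real.sin_lt_sin_of_lt_of_le_pi_div_two (by linarith) (by linarith) h1
  rw [Real.cos_pi_div_four] at hc
  rw [Real.sin_pi_div_four] at hs
  refine ⟨?_, Real.sin_nonneg_of_nonneg_of_le_pi h0 (by linarith), hs.trans hc⟩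
  have : (0:ℝ) < Real.sqrt 2 / 2 := by positivity
  linarith

/-- The principal fifth root of `w ≠ 0`, `Im w ≥ 0`, lies in the open sector
`{0 < Re k, 0 ≤ Im k < Re k}`. -/
theorem root5_mem_sector {w : ℂ} (hw : w ≠ 0) (him : 0 ≤ w.im) :
    0 < (root5 w).re ∧ 0 ≤ (root5 w).im ∧ (root5 w).im < (root5 w).re := by
  obtain ⟨h0, h1⟩ := arg_div_five_mem him
  obtain ⟨hc, hs, hsc⟩ := sin_lt_cos_of_mem h0 h1
  have hr : 0 < ‖w‖ ^ (5⁻¹ : ℝ) := Real.rpow_pos_of_pos (norm_pos_iff.mpr hw) _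
  rw [root5_re, root5_im]
  exact ⟨mul_pos hr hc, mul_nonneg hr.le hs, mul_lt_mul_of_pos_left hsc hr⟩

/-- A complex number in the sector `{0 < Re k, 0 ≤ Im k < Re k}` has argument in `[0, π/4)`. -/
theorem arg_mem_of_sector {k : ℂ} (hre : 0 < k.re) (him : 0 ≤ k.im) (hlt : k.im < k.re) :
    0 ≤ arg k ∧ arg k < Real.pi / 4 := by
  refine ⟨arg_nonneg_iff.mpr him, ?_⟩
  have hlt2 : |arg k| < Real.pi / 2 := abs_arg_lt_pi_div_two_iff.mpr (Or.inl hre)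
  have hk2 : arg k < Real.pi / 2 := (abs_lt.mp hlt2).2
  have hk1 : -(Real.pi / 2) < arg k := (abs_lt.mp hlt2).1
  by_contra h
  push Not at h
  have htan : Real.tan (Real.pi / 4) ≤ Real.tan (arg k) :=
    (Real.strictMonoOn_tan.le_iff_le ⟨by linarith [Real.pi_pos], by linarith [Real.pi_pos]⟩
      ⟨hk1, hk2⟩).mpr h
  rw [Real.tan_pi_div_four, tan_arg] at htan
  have : k.im / k.re < 1 := (div_lt_one hre).mpr hlt
  linarith

/-- Two points of the sector with the same fifth power coincide. -/
theorem eq_of_pow_five_eq_of_sector {k k' : ℂ} (hre : 0 < k.re) (him : 0 ≤ k.im)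
    (hlt : k.im < k.re) (hre' : 0 < k'.re) (him' : 0 ≤ k'.im) (hlt' : k'.im < k'.re)
    (h : k ^ 5 = k' ^ 5) : k = k' := by
  obtain ⟨ha0, ha1⟩ := arg_mem_of_sector hre him hlt
  obtain ⟨hb0, hb1⟩ := arg_mem_of_sector hre' him' hlt'
  have hk : k ≠ 0 := fun h0 => by simp [h0] at hre
  have hk' : k' ≠ 0 := fun h0 => by simp [h0] at hre'
  have hnorm : ‖k‖ = ‖k'‖ := by
    have h5 : ‖k‖ ^ 5 = ‖k'‖ ^ 5 := by rw [← norm_pow, ← norm_pow, h]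
    exact (pow_left_inj₀ (norm_nonneg _) (norm_nonneg _) (by norm_num)).mp h5
  have hexp : exp ((5 : ℕ) * (arg k * I)) = exp ((5 : ℕ) * (arg k' * I)) := by
    rw [Complex.exp_nat_mul, Complex.exp_nat_mul]
    have e1 : k ^ 5 = (‖k‖ : ℂ) ^ 5 * exp (arg k * I) ^ 5 := by
      rw [← mul_pow, norm_mul_exp_arg_mul_I]
    have e2 : k' ^ 5 = (‖k'‖ : ℂ) ^ 5 * exp (arg k' * I) ^ 5 := by
      rw [← mul_pow, norm_mul_exp_arg_mul_I]
    have hn0 : (‖k‖ : ℂ) ^ 5 ≠ 0 := pow_ne_zero _ (ofReal_ne_zero.mpr (norm_ne_zero_iff.mpr hk))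
    rw [e1, e2, ← hnorm] at h
    exact mul_left_cancel₀ hn0 h
  obtain ⟨n, hn⟩ := exp_eq_exp_iff_exists_int.mp hexp
  have hreal : 5 * arg k = 5 * arg k' + n * (2 * Real.pi) := by
    have h1 : ((5 : ℕ) : ℂ) * (arg k * I) = ((5 * arg k : ℝ) : ℂ) * I := by push_cast; ring
    have h2 : ((5 : ℕ) : ℂ) * (arg k' * I) + n * (2 * Real.pi * I) =
        ((5 * arg k' + n * (2 * Real.pi) : ℝ) : ℂ) * I := by push_cast; ring
    rw [h1, h2] at hn
    exact_mod_cast mul_right_cancel₀ I_ne_zero hn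
  have hn0 : n = 0 := by
    have hpi := Real.pi_pos
    rcases lt_trichotomy n 0 with hneg | h0 | hpos
    · have : (n : ℝ) ≤ -1 := by exact_mod_cast Int.le_sub_one_iff.mpr hneg
      nlinarith
    · exact h0
    · have : (1 : ℝ) ≤ n := by exact_mod_cast hpos
      nlinarith
  rw [hn0] at hreal
  simp only [Int.cast_zero, zero_mul, add_zero] at hreal
  exact ext_norm_arg hnorm (by linarith)

/-- **The polynomial selector of the principal fifth root.**  For `w ≠ 0` with `Im w ≥ 0`, the
principal fifth root is the unique `k` with `k⁵ = w`, `0 < Re k`, `0 ≤ Im k < Re k`. -/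
theorem eq_root5_iff {w k : ℂ} (hw : w ≠ 0) (him : 0 ≤ w.im) :
    k = root5 w ↔ k ^ 5 = w ∧ 0 < k.re ∧ 0 ≤ k.im ∧ k.im < k.re := by
  constructor
  · rintro rfl
    exact ⟨root5_pow w, root5_mem_sector hw him⟩
  · rintro ⟨h5, hre, him0, hlt⟩
    obtain ⟨hre', him', hlt'⟩ := root5_mem_sector hw him
    exact eq_of_pow_five_eq_of_sector hre him0 hlt hre' him' hlt' (by rw [h5, root5_pow])

/-! ## The graph of the fifth root as a projection -/

/-- Real and imaginary parts of `(s + it)⁵`. -/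
theorem pow_five_re_im (s t : ℝ) :
    (((s : ℂ) + t * I) ^ 5).re = s ^ 5 - 10 * s ^ 3 * t ^ 2 + 5 * s * t ^ 4 ∧
      (((s : ℂ) + t * I) ^ 5).im = 5 * s ^ 4 * t - 10 * s ^ 2 * t ^ 3 + t ^ 5 := by
  constructor <;> simp [pow_succ, mul_re, mul_im] <;> ring

/-- The closed upper half-plane minus the origin, `{(u, v) | v ≥ 0, (u, v) ≠ 0} ⊆ ℝ²`. -/
def upper0 : Set (Fin 2 → ℝ) := {q | 0 ≤ q 1 ∧ (0 < q 1 ∨ q 0 ≠ 0)}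

/-- `upper0` is `ℚ`-semialgebraic. -/
theorem isSemialgebraic_upper0 : IsSemialgebraic ℚ upper0 := by
  have h1 := isSemialgebraic_setOf_eval_nonneg (k := ℚ) (R := ℝ) (X 1 : MvPolynomial (Fin 2) ℚ)
  have h2 := isSemialgebraic_setOf_eval_pos (k := ℚ) (R := ℝ) (X 1 : MvPolynomial (Fin 2) ℚ)
  have h3 := isSemialgebraic_setOf_eval_ne_zero (k := ℚ) (R := ℝ) (X 0 : MvPolynomial (Fin 2) ℚ)
  have e : upper0 = {x : Fin 2 → ℝ | 0 ≤ aeval x (X 1 : MvPolynomial (Fin 2) ℚ)} ∩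
      ({x | 0 < aeval x (X 1 : MvPolynomial (Fin 2) ℚ)} ∪
        {x | aeval x (X 0 : MvPolynomial (Fin 2) ℚ) ≠ 0}) := by
    ext q
    simp [upper0]
  rw [e]
  exact h1.inter (h2.union h3)

/-- A point of `upper0`, as a complex number, is nonzero with nonnegative imaginary part. -/
theorem upper0_ne_zero {q : Fin 2 → ℝ} (hq : q ∈ upper0) :
    ((q 0 : ℂ) + q 1 * I) ≠ 0 ∧ 0 ≤ ((q 0 : ℂ) + q 1 * I).im := by
  have hre : ((q 0 : ℂ) + q 1 * I).re = q 0 := by simp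
  have him : ((q 0 : ℂ) + q 1 * I).im = q 1 := by simp
  refine ⟨fun h => ?_, by rw [him]; exact hq.1⟩
  have h0 : q 0 = 0 := by rw [← hre, h]; simp
  have h1 : q 1 = 0 := by rw [← him, h]; simp
  rcases hq.2 with h | h
  · exact absurd h1 h.ne'
  · exact h h0

/-- `Re w^{1/5}` as a function of `(Re w, Im w)`. -/
def rootRe (q : Fin 2 → ℝ) : ℝ := (root5 ((q 0 : ℂ) + q 1 * I)).re

/-- `Im w^{1/5}` as a function of `(Re w, Im w)`. -/
def rootIm (q : Fin 2 → ℝ) : ℝ := (root5 ((q 0 : ℂ) + q 1 * I)).im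

/-- The selector set: points `x ∈ ℝ⁴` with `(u, v) = (x 0, x 1) ∈ upper0` and, for
`s = x i`, `t = x j`: `(s+it)⁵ = u+iv`, `0 < s`, `0 ≤ t < s`. -/
def rootSelSet (i j : Fin 4) : Set (Fin 4 → ℝ) :=
  {x | x i ^ 5 - 10 * x i ^ 3 * x j ^ 2 + 5 * x i * x j ^ 4 = x 0 ∧
    5 * x i ^ 4 * x j - 10 * x i ^ 2 * x j ^ 3 + x j ^ 5 = x 1 ∧
      0 < x i ∧ 0 ≤ x j ∧ x j < x i ∧ (0 ≤ x 1 ∧ (0 < x 1 ∨ x 0 ≠ 0))}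

/-- The selector conditions say exactly: `(u,v) ∈ upper0` and `s + it` is the principal root. -/
theorem rootSel_iff {u v s t : ℝ} :
    (s ^ 5 - 10 * s ^ 3 * t ^ 2 + 5 * s * t ^ 4 = u ∧ 5 * s ^ 4 * t - 10 * s ^ 2 * t ^ 3 + t ^ 5 = v ∧
      0 < s ∧ 0 ≤ t ∧ t < s ∧ (0 ≤ v ∧ (0 < v ∨ u ≠ 0))) ↔
      (0 ≤ v ∧ (0 < v ∨ u ≠ 0)) ∧ (s : ℂ) + t * I = root5 (u + v * I) := by
  constructor
  · rintro ⟨h1, h2, hs, ht, hts, hdom⟩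
    have hq : (![u, v] : Fin 2 → ℝ) ∈ upper0 := by simpa [upper0] using hdom
    obtain ⟨hw, him⟩ := upper0_ne_zero hq
    simp only [Matrix.cons_val_zero, Matrix.cons_val_one] at hw him
    refine ⟨hdom, (eq_root5_iff hw him).mpr ⟨?_, by simpa using hs, by simpa using ht,
      by simpa using hts⟩⟩
    apply Complex.ext
    · rw [(pow_five_re_im s t).1, h1]; simp
    · rw [(pow_five_re_im s t).2, h2]; simp
  · rintro ⟨hdom, hk⟩
    have hq : (![u, v] : Fin 2 → ℝ) ∈ upper0 := by simpa [upper0] using hdom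
    obtain ⟨hw, him⟩ := upper0_ne_zero hq
    simp only [Matrix.cons_val_zero, Matrix.cons_val_one] at hw him
    obtain ⟨h5, hs, ht, hts⟩ := (eq_root5_iff hw him).mp hk
    have hre := congrArg Complex.re h5
    have him5 := congrArg Complex.im h5
    rw [(pow_five_re_im s t).1] at hre
    rw [(pow_five_re_im s t).2] at him5
    simp only [add_re, ofReal_re, mul_re, I_re, mul_zero, ofReal_im, I_im, mul_one, sub_self,
      add_zero, add_im, mul_im, zero_add] at hre him5 hs ht hts
    exact ⟨hre, him5, by simpa using hs, by simpa using ht, by simpa using hts, hdom⟩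

/-- The selector set is `ℚ`-semialgebraic (polynomial (in)equalities with integer coefficients). -/
theorem isSemialgebraic_rootSelSet (i j : Fin 4) : IsSemialgebraic ℚ (rootSelSet i j) := by
  have e1 := isSemialgebraic_setOf_eval_eq_zero (k := ℚ) (R := ℝ)
    (X i ^ 5 - 10 * X i ^ 3 * X j ^ 2 + 5 * X i * X j ^ 4 - X 0 : MvPolynomial (Fin 4) ℚ)
  have e2 := isSemialgebraic_setOf_eval_eq_zero (k := ℚ) (R := ℝ)
    (5 * X i ^ 4 * X j - 10 * X i ^ 2 * X j ^ 3 + X j ^ 5 - X 1 : MvPolynomial (Fin 4) ℚ)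
  have e3 := isSemialgebraic_setOf_eval_pos (k := ℚ) (R := ℝ) (X i : MvPolynomial (Fin 4) ℚ)
  have e4 := isSemialgebraic_setOf_eval_nonneg (k := ℚ) (R := ℝ) (X j : MvPolynomial (Fin 4) ℚ)
  have e5 := isSemialgebraic_setOf_eval_pos (k := ℚ) (R := ℝ) (X i - X j : MvPolynomial (Fin 4) ℚ)
  have e6 := isSemialgebraic_setOf_eval_nonneg (k := ℚ) (R := ℝ) (X 1 : MvPolynomial (Fin 4) ℚ)
  have e7 := isSemialgebraic_setOf_eval_pos (k := ℚ) (R := ℝ) (X 1 : MvPolynomial (Fin 4) ℚ)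
  have e8 := isSemialgebraic_setOf_eval_ne_zero (k := ℚ) (R := ℝ) (X 0 : MvPolynomial (Fin 4) ℚ)
  refine (congrArg (IsSemialgebraic (R := ℝ) ℚ) ?_).mpr
    (e1.inter (e2.inter (e3.inter (e4.inter (e5.inter (e6.inter (e7.union e8)))))))
  ext x
  simp only [rootSelSet, mem_setOf_eq, mem_inter_iff, mem_union, map_sub, map_add, map_mul, map_pow,
    MvPolynomial.aeval_X, map_ofNat, sub_eq_zero, sub_pos]

/-- **`Re w^{1/5}` is `ℚ`-semialgebraic** on the closed upper half-plane minus the origin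
(Tarski–Seidenberg applied to the polynomial selector). -/
theorem isSemialgebraicFunOn_rootRe : IsSemialgebraicFunOn ℚ upper0 rootRe := by
  rw [isSemialgebraicFunOn_iff]
  convert tarski_seidenberg_real_holds (isSemialgebraic_rootSelSet 2 3) using 1
  ext v
  simp only [mem_setOf_eq, mem_image]
  have e0 : (Fin.init v : Fin 2 → ℝ) 0 = v 0 := rfl
  have e1 : (Fin.init v : Fin 2 → ℝ) 1 = v 1 := rfl
  have e2 : v (Fin.last 2) = v 2 := rfl
  constructor
  · rintro ⟨hdom, hval⟩
    refine ⟨Fin.snoc v (rootIm (Fin.init v)), ?_, by ext i; simp⟩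
    have s0 : (Fin.snoc v (rootIm (Fin.init v)) : Fin 4 → ℝ) 0 = v 0 := rfl
    have s1 : (Fin.snoc v (rootIm (Fin.init v)) : Fin 4 → ℝ) 1 = v 1 := rfl
    have s2 : (Fin.snoc v (rootIm (Fin.init v)) : Fin 4 → ℝ) 2 = v 2 := rfl
    have s3 : (Fin.snoc v (rootIm (Fin.init v)) : Fin 4 → ℝ) 3 = rootIm (Fin.init v) :=
      Fin.snoc_last (α := fun _ => ℝ) _ v
    show (Fin.snoc v (rootIm (Fin.init v)) : Fin 4 → ℝ) ∈ rootSelSet 2 3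
    rw [rootSelSet, mem_setOf_eq, s0, s1, s2, s3, rootSel_iff]
    refine ⟨by simpa [upper0, e0, e1] using hdom, ?_⟩
    rw [e2] at hval
    apply Complex.ext
    · simpa [rootRe, e0, e1] using hval
    · simp [rootIm, e0, e1]
  · rintro ⟨x, hx, rfl⟩
    rw [rootSelSet, mem_setOf_eq, rootSel_iff] at hx
    obtain ⟨hdom, hk⟩ := hx
    refine ⟨by simpa [upper0, Fin.init] using hdom, ?_⟩
    have := congrArg Complex.re hk
    simpa [rootRe, Fin.init] using this

/-- **`Im w^{1/5}` is `ℚ`-semialgebraic** on the closed upper half-plane minus the origin. -/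
theorem isSemialgebraicFunOn_rootIm : IsSemialgebraicFunOn ℚ upper0 rootIm := by
  rw [isSemialgebraicFunOn_iff]
  convert tarski_seidenberg_real_holds (isSemialgebraic_rootSelSet 3 2) using 1
  ext v
  simp only [mem_setOf_eq, mem_image]
  have e0 : (Fin.init v : Fin 2 → ℝ) 0 = v 0 := rfl
  have e1 : (Fin.init v : Fin 2 → ℝ) 1 = v 1 := rfl
  have e2 : v (Fin.last 2) = v 2 := rfl
  constructor
  · rintro ⟨hdom, hval⟩
    refine ⟨Fin.snoc v (rootRe (Fin.init v)), ?_, by ext i; simp⟩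
    have s0 : (Fin.snoc v (rootRe (Fin.init v)) : Fin 4 → ℝ) 0 = v 0 := rfl
    have s1 : (Fin.snoc v (rootRe (Fin.init v)) : Fin 4 → ℝ) 1 = v 1 := rfl
    have s2 : (Fin.snoc v (rootRe (Fin.init v)) : Fin 4 → ℝ) 2 = v 2 := rfl
    have s3 : (Fin.snoc v (rootRe (Fin.init v)) : Fin 4 → ℝ) 3 = rootRe (Fin.init v) :=
      Fin.snoc_last (α := fun _ => ℝ) _ v
    show (Fin.snoc v (rootRe (Fin.init v)) : Fin 4 → ℝ) ∈ rootSelSet 3 2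
    rw [rootSelSet, mem_setOf_eq, s0, s1, s2, s3, rootSel_iff]
    refine ⟨by simpa [upper0, e0, e1] using hdom, ?_⟩
    rw [e2] at hval
    apply Complex.ext
    · simp [rootRe, e0, e1]
    · simpa [rootIm, e0, e1] using hval
  · rintro ⟨x, hx, rfl⟩
    rw [rootSelSet, mem_setOf_eq, rootSel_iff] at hx
    obtain ⟨hdom, hk⟩ := hx
    refine ⟨by simpa [upper0, Fin.init] using hdom, ?_⟩
    have := congrArg Complex.im hk
    simpa [rootIm, Fin.init] using this

end SoloBlind

end Summit.KontsevichZagierPeriods.KontsevichZagierPeriods.Theorems
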